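import Summits.Ventures.CertifiedManyBodySolver.Observables.SourcedGibbsTrialCapKSpaceFermi
import HarnessLib

/-!
# The HF–BCS sourced cap in momentum space (IX): the Fermi function of a Hermitian matrix on a vector whose
# SQUARE-image is a multiple of itself (`A(Au) = E²u`) — the block algebra behind the spin-density-wave + BCS
# `4 × 4` Nambu blocks

HONEST FRAMING: zero compute; every statement is a PROVED identity of finite-dimensional linear algebra; no number is
claimed. Generic in the matrix `A`: this is the step of the antiferromagnetic(spin-density-wave) + `d`-wave-pinned BCS
quasi-free cap chain (`Observables/SourcedGibbsTrialCapSpinTrial.lean`) that replaces the explicit `2 × 2` BdG block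
exponential of the paramagnetic chain (`exp_smul_mulVec_of_two_block`, file (I)): for the staggered-field Nambu matrix the
momentum blocks are `4 × 4`, but their SQUARE is `2 × 2`-block-diagonal, so every plane-wave block vector splits into
(at most two) vectors `u` with `A(Au) = E²u`, `E = E_±(k) = √((√(ε_k²+M²) ± μ')² + Δ_k²)`; on each such `u` the matrix
functions `e^{βA}` and `(1 + e^{βA})⁻¹` act by the explicit two-term formulas below. Not a statement about order; not a
superconductivity verdict.

Cell `hubbard-obs` (D-0042 / D-0082), seat `hubbard-obs-pin-2` (`prover-hubbard-obs-pin-2-g7-0`).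

## Contents (all for `A` Hermitian, `E ≥ 0` real, `A *ᵥ (A *ᵥ u) = E² • u`)

* `mulVec_eq_zero_of_mulVec_mulVec_eq_zero` — `A(Au) = 0 ⟹ Au = 0` (`‖Au‖² = ⟨u, A(Au)⟩`).
* `exp_smul_mulVec_of_sq_eigen` — `e^{βA} u = cosh(βE)·u + (sinh(βE)/E)·Au` (eigenvectors `Au ± E u`; at `E = 0`,
  `Au = 0` and the formula reads `e^{βA}u = u` with Lean's `x/0 = 0`).
* `one_add_exp_smul_mulVec_of_sq_eigen`, `one_add_exp_smul_mulVec_mulVec_of_sq_eigen` — the symbol of `1 + e^{βA}` on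
  the pair `(u, Au)`.
* `fermi_mulVec_of_sq_eigen` — **`(1 + e^{βA})⁻¹ u = ½·u − (tanh(βE/2)/(2E))·Au`** (the half-angle block inverse,
  `tanh_half_eq_sinh_div` of file (II); valid at `E = 0`).

References: von Delft–Ralph, Phys. Rep. 345 (2001) 61, §4.2 (BdG block algebra) [VondelftRalph2001]; Bach–Lieb–Solovej,
J. Stat. Phys. 76 (1994) 3, §2 [BachLiebSolovej1994]; O. Bratteli, D. W. Robinson, *OAQSM 2* (1997) §5.2.4
[BratteliRobinsonII1997].
-/

noncomputable section

open Matrix Finset Literature.MathematicalPhysics.QuantumLattice Literature.Probability.LatticeModels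
open scoped ComplexConjugate ComplexOrder

namespace Summit.Ventures.CertifiedManyBodySolver.Observables

section SqEigen

variable {n : Type*} [Fintype n] [DecidableEq n]

omit [DecidableEq n] in
/-- For a Hermitian matrix, `A(Au) = 0` forces `Au = 0` (`⟨Au, Au⟩ = ⟨u, Aᴴ(Au)⟩ = ⟨u, A(Au)⟩ = 0`). [folklore] -/
theorem mulVec_eq_zero_of_mulVec_mulVec_eq_zero {A : Matrix n n ℂ} (hA : A.IsHermitian) {u : n → ℂ}
    (h : A *ᵥ (A *ᵥ u) = 0) : A *ᵥ u = 0 := by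
  have key : star (A *ᵥ u) ⬝ᵥ (A *ᵥ u) = 0 := by
    rw [star_mulVec, hA.eq, ← dotProduct_mulVec, h, dotProduct_zero]
  exact dotProduct_star_self_eq_zero.mp key

/-- **The exponential on a square-eigenvector.** If `A` is Hermitian and `A(Au) = E²u` with `E ≥ 0`, then
`e^{βA} u = cosh(βE)·u + (sinh(βE)/E)·(Au)` (eigenvectors `Au ± E·u` of eigenvalues `±E`; at `E = 0`, `Au = 0` and both
sides are `u`, with Lean's `x/0 = 0`). [cite: VondelftRalph2001, §4.2] -/
theorem exp_smul_mulVec_of_sq_eigen {A : Matrix n n ℂ} (hA : A.IsHermitian) {u : n → ℂ} (β : ℝ) {E : ℝ}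
    (hE : 0 ≤ E) (hu : A *ᵥ (A *ᵥ u) = ((E ^ 2 : ℝ) : ℂ) • u) :
    NormedSpace.exp ((β : ℂ) • A) *ᵥ u =
      ((Real.cosh (β * E) : ℝ) : ℂ) • u + ((Real.sinh (β * E) / E : ℝ) : ℂ) • (A *ᵥ u) := by
  rcases eq_or_lt_of_le hE with hE0 | hEpos
  · -- degenerate: `E = 0`, `A(Au) = 0`, hence `Au = 0`
    have hE0' : E = 0 := hE0.symm
    have h0 : A *ᵥ (A *ᵥ u) = 0 := by rw [hu, hE0']; simp
    have hAu : A *ᵥ u = 0 := mulVec_eq_zero_of_mulVec_mulVec_eq_zero hA h0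
    have hv : ((β : ℂ) • A) *ᵥ u = (0 : ℂ) • u := by rw [Matrix.smul_mulVec, hAu, smul_zero, zero_smul]
    rw [exp_mulVec_of_mulVec_eq_smul _ hv, hAu, hE0']
    simp
  · have hE0 : E ≠ 0 := hEpos.ne'
    have hE0' : (E : ℂ) ≠ 0 := by exact_mod_cast hE0
    -- eigenvectors `w± = Au ± E u`
    have key : ∀ s : ℝ, s ^ 2 = E ^ 2 →
        ((β : ℂ) • A) *ᵥ (A *ᵥ u + (s : ℂ) • u) = ((β * s : ℝ) : ℂ) • (A *ᵥ u + (s : ℂ) • u) := by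
      intro s hs
      rw [Matrix.smul_mulVec, Matrix.mulVec_add, Matrix.mulVec_smul, hu]
      ext i
      simp only [Pi.add_apply, Pi.smul_apply, smul_eq_mul]
      have hs' : (s : ℂ) ^ 2 = (E : ℂ) ^ 2 := by exact_mod_cast hs
      push_cast
      linear_combination (β : ℂ) * u i * hs'.symm
    have hp := exp_mulVec_of_mulVec_eq_smul _ (key E rfl)
    have hm := exp_mulVec_of_mulVec_eq_smul _ (key (-E) (by rw [neg_sq]))
    have hv0 : u = ((2 * E : ℝ) : ℂ)⁻¹ • ((A *ᵥ u + (E : ℂ) • u) - (A *ᵥ u + ((-E : ℝ) : ℂ) • u)) := by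
      ext i
      simp only [Pi.add_apply, Pi.smul_apply, Pi.sub_apply, smul_eq_mul]
      push_cast
      field_simp
      ring
    calc NormedSpace.exp ((β : ℂ) • A) *ᵥ u
        = ((2 * E : ℝ) : ℂ)⁻¹ • (NormedSpace.exp ((β : ℂ) • A) *ᵥ (A *ᵥ u + (E : ℂ) • u) -
            NormedSpace.exp ((β : ℂ) • A) *ᵥ (A *ᵥ u + ((-E : ℝ) : ℂ) • u)) := by
          conv_lhs => rw [hv0]
          rw [Matrix.mulVec_smul, Matrix.mulVec_sub]
      _ = ((2 * E : ℝ) : ℂ)⁻¹ • (Complex.exp ((β * E : ℝ) : ℂ) • (A *ᵥ u + (E : ℂ) • u) -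
            Complex.exp ((β * -E : ℝ) : ℂ) • (A *ᵥ u + ((-E : ℝ) : ℂ) • u)) := by rw [hp, hm]
      _ = _ := by
          ext i
          simp only [Pi.add_apply, Pi.smul_apply, Pi.sub_apply, smul_eq_mul]
          rw [Real.cosh_eq, Real.sinh_eq]
          have e1 : ((β * -E : ℝ) : ℂ) = -((β * E : ℝ) : ℂ) := by push_cast; ring
          rw [e1]
          push_cast
          field_simp
          ring

/-- The symbol of `1 + e^{βA}` on `u`: `(1 + e^{βA}) u = (1 + cosh βE)·u + (sinh(βE)/E)·Au`.
[cite: VondelftRalph2001, §4.2] -/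
theorem one_add_exp_smul_mulVec_of_sq_eigen {A : Matrix n n ℂ} (hA : A.IsHermitian) {u : n → ℂ} (β : ℝ) {E : ℝ}
    (hE : 0 ≤ E) (hu : A *ᵥ (A *ᵥ u) = ((E ^ 2 : ℝ) : ℂ) • u) :
    (1 + NormedSpace.exp ((β : ℂ) • A)) *ᵥ u =
      ((1 + Real.cosh (β * E) : ℝ) : ℂ) • u + ((Real.sinh (β * E) / E : ℝ) : ℂ) • (A *ᵥ u) := by
  rw [Matrix.add_mulVec, Matrix.one_mulVec, exp_smul_mulVec_of_sq_eigen hA β hE hu]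
  push_cast
  module

/-- The symbol of `1 + e^{βA}` on `Au`: `(1 + e^{βA})(Au) = (E·sinh βE)·u + (1 + cosh βE)·Au` (`e^{βA}` commutes with `A`).
[cite: VondelftRalph2001, §4.2] -/
theorem one_add_exp_smul_mulVec_mulVec_of_sq_eigen {A : Matrix n n ℂ} (hA : A.IsHermitian) {u : n → ℂ} (β : ℝ)
    {E : ℝ} (hE : 0 ≤ E) (hu : A *ᵥ (A *ᵥ u) = ((E ^ 2 : ℝ) : ℂ) • u) :
    (1 + NormedSpace.exp ((β : ℂ) • A)) *ᵥ (A *ᵥ u) =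
      ((E * Real.sinh (β * E) : ℝ) : ℂ) • u + ((1 + Real.cosh (β * E) : ℝ) : ℂ) • (A *ᵥ u) := by
  have hcomm : (1 + NormedSpace.exp ((β : ℂ) • A)) * A = A * (1 + NormedSpace.exp ((β : ℂ) • A)) := by
    rw [Matrix.add_mul, Matrix.mul_add, Matrix.one_mul, Matrix.mul_one]
    congr 1
    exact (((Commute.refl A).smul_right (β : ℂ)).exp_right).eq.symm
  rw [Matrix.mulVec_mulVec, hcomm, ← Matrix.mulVec_mulVec, one_add_exp_smul_mulVec_of_sq_eigen hA β hE hu,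
    Matrix.mulVec_add, Matrix.mulVec_smul, Matrix.mulVec_smul, hu]
  rcases eq_or_lt_of_le hE with hE0 | hEpos
  · have hE0' : E = 0 := hE0.symm
    rw [hE0']
    simp
  · have hE0' : (E : ℂ) ≠ 0 := by exact_mod_cast hEpos.ne'
    ext i
    simp only [Pi.add_apply, Pi.smul_apply, smul_eq_mul]
    push_cast
    field_simp
    ring

/-- **The Fermi function on a square-eigenvector.** If `A` is Hermitian and `A(Au) = E²u` with `E ≥ 0`, then
`(1 + e^{βA})⁻¹ u = ½·u − (tanh(βE/2)/(2E))·Au`: the vector `w = ½u − (tanh(βE/2)/(2E))·Au` satisfies `(1 + e^{βA}) w = u`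
by the two symbols above and `tanh(x/2) = sinh x/(1 + cosh x)`, `cosh² − sinh² = 1`; and `1 + e^{βA}` is invertible
(positive definite). At `E = 0` the formula reads `½u` (`Au = 0`). [cite: VondelftRalph2001, §4.2] [cite: BratteliRobinsonII1997, §5.2.4] -/
theorem fermi_mulVec_of_sq_eigen {A : Matrix n n ℂ} (hA : A.IsHermitian) {u : n → ℂ} (β : ℝ) {E : ℝ}
    (hE : 0 ≤ E) (hu : A *ᵥ (A *ᵥ u) = ((E ^ 2 : ℝ) : ℂ) • u) :
    (1 + NormedSpace.exp ((β : ℂ) • A))⁻¹ *ᵥ u =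
      ((1 / 2 : ℝ) : ℂ) • u - ((Real.tanh (β * E / 2) / (2 * E) : ℝ) : ℂ) • (A *ᵥ u) := by
  set N : Matrix n n ℂ := 1 + NormedSpace.exp ((β : ℂ) • A) with hN
  set w : n → ℂ := ((1 / 2 : ℝ) : ℂ) • u - ((Real.tanh (β * E / 2) / (2 * E) : ℝ) : ℂ) • (A *ᵥ u) with hw
  -- `N w = u`: the two scalar coefficient identities (in `ℝ`), then the vector identity
  have hcs : Real.cosh (β * E) ^ 2 - Real.sinh (β * E) ^ 2 = 1 := Real.cosh_sq_sub_sinh_sq _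
  have hden : 1 + Real.cosh (β * E) ≠ 0 := by have := Real.one_le_cosh (β * E); positivity
  have ht : Real.tanh (β * E / 2) = Real.sinh (β * E) / (1 + Real.cosh (β * E)) := tanh_half_eq_sinh_div _
  have cu : (1 / 2 : ℝ) * (1 + Real.cosh (β * E)) - Real.tanh (β * E / 2) / (2 * E) * (E * Real.sinh (β * E)) = 1 := by
    rcases eq_or_lt_of_le hE with hE0 | hEpos
    · rw [← hE0]; norm_num
    · rw [ht]; field_simp; nlinarith [hcs]
  have cAu : (1 / 2 : ℝ) * (Real.sinh (β * E) / E) - Real.tanh (β * E / 2) / (2 * E) * (1 + Real.cosh (β * E)) = 0 := by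
    rcases eq_or_lt_of_le hE with hE0 | hEpos
    · rw [← hE0]; simp
    · rw [ht]; field_simp; ring
  have cu' : ((1 / 2 : ℝ) : ℂ) * ((1 + Real.cosh (β * E) : ℝ) : ℂ) -
      ((Real.tanh (β * E / 2) / (2 * E) : ℝ) : ℂ) * ((E * Real.sinh (β * E) : ℝ) : ℂ) = 1 := by exact_mod_cast cu
  have cAu' : ((1 / 2 : ℝ) : ℂ) * ((Real.sinh (β * E) / E : ℝ) : ℂ) -
      ((Real.tanh (β * E / 2) / (2 * E) : ℝ) : ℂ) * ((1 + Real.cosh (β * E) : ℝ) : ℂ) = 0 := by exact_mod_cast cAu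
  have hNw : N *ᵥ w = u := by
    rw [hw, Matrix.mulVec_sub, Matrix.mulVec_smul, Matrix.mulVec_smul, hN,
      one_add_exp_smul_mulVec_of_sq_eigen hA β hE hu, one_add_exp_smul_mulVec_mulVec_of_sq_eigen hA β hE hu]
    ext i
    simp only [Pi.add_apply, Pi.smul_apply, Pi.sub_apply, smul_eq_mul]
    linear_combination (u i) * cu' + ((A *ᵥ u) i) * cAu'
  -- `N` is invertible (positive definite)
  have hexp : (NormedSpace.exp ((β : ℂ) • A)).PosDef := by
    have := posDef_gibbsWeight (-β) hA
    simpa [gibbsWeight] using this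
  have hNdet : IsUnit N.det :=
    (Matrix.isUnit_iff_isUnit_det _).mp (Matrix.PosDef.one.add_posSemidef hexp.posSemidef).isUnit
  calc N⁻¹ *ᵥ u = N⁻¹ *ᵥ (N *ᵥ w) := by rw [hNw]
    _ = (N⁻¹ * N) *ᵥ w := by rw [Matrix.mulVec_mulVec]
    _ = w := by rw [Matrix.nonsing_inv_mul _ hNdet, Matrix.one_mulVec]

end SqEigen

end Summit.Ventures.CertifiedManyBodySolver.Observables

end
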